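import Summits.BirchSwinnertonDyer.Rank1Residual.AdditivePotMult.PotMultKatoFirstUnitIndexClass
import Summits.BirchSwinnertonDyer.Rank1Residual.AdditivePotMult.PotMultWuthrichFirstUnitIndex
import HarnessLib

/-!
# X3♯(M) (REDUCIBLE `E[p]`, potentially multiplicative), EVERY odd `p` (`p = 3` included): `μ = 0` from
# ANY unit coefficient, `rank E(ℚ) ≤ n₀`, and the MAIN CONJECTURE at the pair (class level) — the
# X3♯(M) twin of n1011-p07's `PotMultKatoFirstUnitIndexClass.lean` over this seat's
# `PotMultWuthrichFirstUnitIndex.lean` (cell `b2b-bsdres`, team n1011, seat p12 (gen 2), row T-E3dM-X3)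

HONEST FRAMING (cell `b2b-bsdres`, run/shared/lean/b2b/bsd-rank1-residual/, verbatim in every
file): the goal of the cell is to DELETE the COMBINATION-SHAPED residual classes of the
Birch–Swinnerton-Dyer formula for ALL analytic-rank `≤ 1` elliptic curves over `ℚ` — "full BSD
formula for every rank `≤ 1` curve in class `C`" assembled STRICTLY from published theorems — so
that the rank-`≤ 1` remainder becomes exactly the CONSTRUCTION-SHAPED classes, which are TYPED
(missing-input `Prop`s), NOT attempted. This is not "finishing BSD". Team n1011 (RESIDUAL-MAP §I
N10 LOWER half and O7 on the X3♯(M) rows, every odd `p`): research route on CONSTRUCTION-SHAPED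
items; labels and marks UNCHANGED; nothing booked; NO Literature fact minted; NO definition
(currencies of record: census-ctyper1's `CensusQ6.Mult[Odd]FirstUnitIndexAt`, n1011-p06's binders
`Mult[Odd]BranchUnitCoeffCert`, p01's `CharLamLeAt`, p10's `BudgetLeLambdaAt`). Named facts enter as
HYPOTHESES only: `hW16` = Wuthrich 2014 Thm. 16 (half-eigen divisibility, REDUCIBLE `E[p]`,
`Wuthrich2014.thm16_halfEigenCharIdeal_dvd_cyclotomicPrime`); `hmodD` = modular parametrisation data.
A census record / unit-coefficient binder is CERTIFICATE-EVIDENCE, never a fact; the budget is a typed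
per-curve input. Debt 0.

## What this file proves (p07's FILE 1b proofs verbatim with (hK ∧ Surj ∧ tower) ↦ hW16 ∧ reducibility)

* §1 `ClassX3M.mu_eq_zero_of_wuthrichHalf_of_unitCoeffCert[_odd]`: `hW16` + p06's weaker binder
  `Mult[Odd]BranchUnitCoeffCert W p` (SOME coefficient is a unit) ⟹ for every cyclotomic dual datum and
  generator: `X` torsion, `fE` of unit content, `μ(fE) = 0` — Greenberg–Vatsal's `μ`-side on a
  REDUCIBLE row, per certified pair (no claim about which isogenous curve has `μ = 0` in general: the
  certificate is read on THIS `E`'s branch series).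
* §2 `ClassX3M.mordellWeilRank_le_of_wuthrichHalf_of_firstUnitIndex[_odd]`: `rank E(ℚ) ≤ n₀`.
* §3 `ClassX3M.mainConjecture_of_wuthrichHalf_of_firstUnitIndex_of_budget[_odd]` (record at index `b`
  + budget ⟹ `X` torsion, `μ(X) = 0`, `λ(X) = b`, `char = (g)` with `g` of unit content) and
  `ClassX3M.minimalPackage_of_wuthrichHalf_of_firstUnitIndex_mordellWeilRank[_odd]` (record at index
  `rank E(ℚ)`: NO lower input).

NOT binders: `Surj`, tower, `5 ≤ p`, `¬CM`, `hna`, `hL20`, `hPal`. Labels UNCHANGED; nothing booked;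
X3 stays CONSTRUCTION-SHAPED.

BUDGET SOURCE ON X3 ROWS (n1011-r2 GEN 7, ROUTE-2 II.13.2; doc-only scope note): n1011-p10's typed input
`BudgetLeLambdaAt p W b` is a THEOREM for `b ≤ rank E(ℚ)` (p07's `budgetLeLambdaAt_of_le_mordellWeilRank`);
for `b > rank E(ℚ)` its printed discharge (Emerton–Pollack–Weston 2006 Cor. 3.2.5 + Thm. 3.1.1) assumes
`ρ̄` ABSOLUTELY IRREDUCIBLE, so on X3 (reducible) rows the budget is an UNPRINTED per-pair binder —
candidate discharge Greenberg LNM 1716 Prop. 4.14 (no finite-index Λ-submodule) + Greenberg 2010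
(Kyoto J. Math. 50) Prop. 3.2.1 (b) + II.10.9, to be instantiated (sub-target T-E3gX3-bud). Every EPW
citation below is the source of the typed input on IRREDUCIBLE rows only.

References: C. Wuthrich, Doc. Math. 19 (2014) Thm. 16, §3 [Wuthrich2014]; R. Greenberg, LNM 1716
(1999) §1, §3 Lemma 3.1 [GreenbergLNM1716]; R. Greenberg, V. Vatsal, Invent. Math. 142 (2000) p. 4
[GreenbergVatsal2000]; M. Emerton, R. Pollack, T. Weston, Invent. Math. 163 (2006) §3
[EmertonPollackWeston2006]; L. Washington, GTM 83 (1997) §7.1, §13.2 [Washington1997]; W. Stein,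
C. Wuthrich, Math. Comp. 82 (2013) §11 [SteinWuthrich2013]; B. Mazur, J. Tate, J. Teitelbaum,
Invent. Math. 84 (1986) §I.13 [MazurTateTeitelbaum1986Invent].
-/

set_option autoImplicit false

noncomputable section

open scoped Classical MatrixGroups ModularForm NumberField

namespace Summit.BirchSwinnertonDyer.Rank1Residual.AdditivePotMult

open CongruenceSubgroup WeierstrassCurve NumberField Literature.NumberTheory.EllipticCurves
  Literature.NumberTheory.EllipticCurves.ModularForms
  Literature.NumberTheory.EllipticCurves.Rank1Residual
  Literature.NumberTheory.EllipticCurves.Rank1Residual.Typed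
  Literature.NumberTheory.EllipticCurves.GreenbergVatsal2000
  Literature.NumberTheory.GaloisRepresentations
  Summit.BirchSwinnertonDyer.Rank1Residual.Additive
  Summit.BirchSwinnertonDyer.Rank1Residual.Additive.CensusQ6
  Summit.BirchSwinnertonDyer.Rank1Residual.X1.MuLambda
  Summit.BirchSwinnertonDyer.Rank1Residual.X11a
  Summit.BirchSwinnertonDyer.Rank1Residual.X11a.LambdaNorm
  Summit.BirchSwinnertonDyer.Rank1Residual.Iwasawa
  IsDedekindDomain

variable {W : WeierstrassCurve ℚ} [W.IsElliptic] [W.IsGloballyMinimal] {p : ℕ} [hp : Fact p.Prime]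

/-! ### §1 `μ(X(E/ℚ_∞)) = 0` from ANY unit coefficient, on a REDUCIBLE row -/

/-- **`μ(X(E/ℚ_∞)) = 0` from ANY unit coefficient, X3♯(M), `p ≡ 1 (mod 4)`:** Wuthrich's divisibility +
n1011-p06's weaker binder `MultBranchUnitCoeffCert W p` (SOME coefficient of
`ϖ·L_p⁺(f_{E♭}, ±1, ω^{(p−1)/2}, T)` is a unit) ⟹ for every cyclotomic dual datum and generator: `X`
torsion, `fE` of unit content, `μ(fE) = 0`. Reducibility of `E♭[p]` (`irr_iff_of_model_twist`)
replaces p07's tower line. [cite: Wuthrich2014, Thm. 16 (p. 397)] [cite: GreenbergVatsal2000, p. 4] -/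
theorem ClassX3M.mu_eq_zero_of_wuthrichHalf_of_unitCoeffCert
    (hW16 : Wuthrich2014.thm16_halfEigenCharIdeal_dvd_cyclotomicPrime)
    (hmodD : nonempty_modularParametrizationData)
    (hX : ClassX3M W p) (hp4 : p % 4 = 1) (hcert : MultBranchUnitCoeffCert W p)
    {κ : ZpExtension ℚ p} {γ : Field.absoluteGaloisGroup ℚ}
    (hκ : κ.IsCyclotomic) (hγ : κ.IsTopGenerator γ) (hγ' : IsCyclotomicVariable p γ)
    (D : W.SelmerDualData κ γ) {fE : IwasawaAlgebra p} (hchar : D.charIdeal = Ideal.span {fE}) :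
    D.IsTorsion ∧ HasUnitContent fE ∧ mu fE = 0 := by
  have hp2 : p ≠ 2 := hX.p_ne_two
  obtain ⟨V, iV, iVm, C, hV, hC⟩ := hX.exists_mult_pStar_twist_model
  haveI : NeZero (V.conductorNorm ℤ) := ⟨(V.conductorNorm_pos_holds).ne'⟩
  obtain ⟨Dm⟩ := hmodD V
  obtain ⟨ϖ, hϖ⟩ := exists_periodRatio_parity (p := p) V Dm
  have hirrV : ¬ V.HasIrreducibleModPGaloisRep p := fun hVirr ↦
    hX.classX3.1 ((irr_iff_of_model_twist (W := V) (p := p) (pStar_ne_zero p) ⟨C, hC⟩).mpr hVirr)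
  have heven : Even (p / 2) := ⟨p / 4, by omega⟩
  have hC' : C • V.quadraticTwist (p : ℚ) = W := by
    rw [← pStar_eq_self_of_mod_four_eq_one hp4]; exact hC
  have hϖ' : (ϖ : ℝ) * V.realPeriodRat = plusPeriod Dm.f := by
    rw [if_pos heven] at hϖ; exact hϖ
  by_cases hs : V.HasSplitMultiplicativeReductionAtPrime p
  · obtain ⟨hap, -⟩ := Dm.isNewformOf.cuspCoeff_eq_one_and_sq_of_split hs
    obtain ⟨n, hn⟩ := hcert V C hV hC' Dm.f Dm.isNewformOf 1 (by exact_mod_cast hap) ϖ hϖ'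
    rw [Int.cast_one] at hn
    obtain ⟨hXt, g, hg, -, hunit, hlam⟩ := isTorsion_and_exists_iota_eq_unitContent_of_wuthrichHalf
      hW16 hp2 V C hC hirrV hκ hγ hγ' Dm.isNewformOf D _ (Or.inr (Or.inl ⟨hs, rfl⟩)) ϖ hϖ
      (n := n) (by rw [if_pos heven]; exact hn)
    obtain ⟨hfE, hmu, -⟩ := unitContent_and_mu_eq_zero_and_lam_le_of_mem_span (hchar ▸ hg) hunit hlam
    exact ⟨hXt, hfE, hmu⟩
  · obtain ⟨hap, -⟩ := Dm.isNewformOf.cuspCoeff_eq_neg_one_and_dvd_of_nonsplit hV hs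
    obtain ⟨n, hn⟩ := hcert V C hV hC' Dm.f Dm.isNewformOf (-1) (by exact_mod_cast hap) ϖ hϖ'
    rw [Int.cast_neg, Int.cast_one] at hn
    obtain ⟨hXt, g, hg, -, hunit, hlam⟩ := isTorsion_and_exists_iota_eq_unitContent_of_wuthrichHalf
      hW16 hp2 V C hC hirrV hκ hγ hγ' Dm.isNewformOf D _ (Or.inr (Or.inr ⟨hV, hs, rfl⟩)) ϖ hϖ
      (n := n) (by rw [if_pos heven]; exact hn)
    obtain ⟨hfE, hmu, -⟩ := unitContent_and_mu_eq_zero_and_lam_le_of_mem_span (hchar ▸ hg) hunit hlam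
    exact ⟨hXt, hfE, hmu⟩

/-- **`μ(X(E/ℚ_∞)) = 0` from ANY unit coefficient, X3♯(M), `p ≡ 3 (mod 4)` (`p = 3` included)**, binder
`MultOddBranchUnitCoeffCert W p`. [cite: Wuthrich2014, Thm. 16 (p. 397)] [cite: GreenbergVatsal2000, p. 4] -/
theorem ClassX3M.mu_eq_zero_of_wuthrichHalf_of_unitCoeffCert_odd
    (hW16 : Wuthrich2014.thm16_halfEigenCharIdeal_dvd_cyclotomicPrime)
    (hmodD : nonempty_modularParametrizationData)
    (hX : ClassX3M W p) (hp4 : p % 4 = 3) (hcert : MultOddBranchUnitCoeffCert W p)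
    {κ : ZpExtension ℚ p} {γ : Field.absoluteGaloisGroup ℚ}
    (hκ : κ.IsCyclotomic) (hγ : κ.IsTopGenerator γ) (hγ' : IsCyclotomicVariable p γ)
    (D : W.SelmerDualData κ γ) {fE : IwasawaAlgebra p} (hchar : D.charIdeal = Ideal.span {fE}) :
    D.IsTorsion ∧ HasUnitContent fE ∧ mu fE = 0 := by
  have hp2 : p ≠ 2 := hX.p_ne_two
  obtain ⟨V, iV, iVm, C, hV, hC⟩ := hX.exists_mult_pStar_twist_model
  haveI : NeZero (V.conductorNorm ℤ) := ⟨(V.conductorNorm_pos_holds).ne'⟩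
  obtain ⟨Dm⟩ := hmodD V
  obtain ⟨ϖ, hϖ⟩ := exists_periodRatio_parity (p := p) V Dm
  have hirrV : ¬ V.HasIrreducibleModPGaloisRep p := fun hVirr ↦
    hX.classX3.1 ((irr_iff_of_model_twist (W := V) (p := p) (pStar_ne_zero p) ⟨C, hC⟩).mpr hVirr)
  have hodd : ¬ Even (p / 2) := by rw [Nat.not_even_iff_odd]; exact ⟨p / 4, by omega⟩
  have hC' : C • V.quadraticTwist (-(p : ℚ)) = W := by
    rw [← pStar_eq_neg_of_mod_four_eq_three hp4]; exact hC
  have hϖ' : (ϖ : ℝ) * V.imaginaryPeriodRat = minusPeriod Dm.f := by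
    rw [if_neg hodd] at hϖ; exact hϖ
  by_cases hs : V.HasSplitMultiplicativeReductionAtPrime p
  · obtain ⟨hap, -⟩ := Dm.isNewformOf.cuspCoeff_eq_one_and_sq_of_split hs
    obtain ⟨n, hn⟩ := hcert V C hV hC' Dm.f Dm.isNewformOf 1 (by exact_mod_cast hap) ϖ hϖ'
    rw [Int.cast_one] at hn
    obtain ⟨hXt, g, hg, -, hunit, hlam⟩ := isTorsion_and_exists_iota_eq_unitContent_of_wuthrichHalf
      hW16 hp2 V C hC hirrV hκ hγ hγ' Dm.isNewformOf D _ (Or.inr (Or.inl ⟨hs, rfl⟩)) ϖ hϖ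
      (n := n) (by rw [if_neg hodd]; exact hn)
    obtain ⟨hfE, hmu, -⟩ := unitContent_and_mu_eq_zero_and_lam_le_of_mem_span (hchar ▸ hg) hunit hlam
    exact ⟨hXt, hfE, hmu⟩
  · obtain ⟨hap, -⟩ := Dm.isNewformOf.cuspCoeff_eq_neg_one_and_dvd_of_nonsplit hV hs
    obtain ⟨n, hn⟩ := hcert V C hV hC' Dm.f Dm.isNewformOf (-1) (by exact_mod_cast hap) ϖ hϖ'
    rw [Int.cast_neg, Int.cast_one] at hn
    obtain ⟨hXt, g, hg, -, hunit, hlam⟩ := isTorsion_and_exists_iota_eq_unitContent_of_wuthrichHalf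
      hW16 hp2 V C hC hirrV hκ hγ hγ' Dm.isNewformOf D _ (Or.inr (Or.inr ⟨hV, hs, rfl⟩)) ϖ hϖ
      (n := n) (by rw [if_neg hodd]; exact hn)
    obtain ⟨hfE, hmu, -⟩ := unitContent_and_mu_eq_zero_and_lam_le_of_mem_span (hchar ▸ hg) hunit hlam
    exact ⟨hXt, hfE, hmu⟩

/-! ### §2 `rank E(ℚ) ≤ n₀ = λ_an` on X3♯(M) -/

/-- **`rank E(ℚ) ≤ n₀` on X3♯(M), `p ≡ 1 (mod 4)`, given the record** — `T^{rank} ∣ fE`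
(`Typed.X_pow_mordellWeilRank_dvd_of_charIdeal_eq_span` on some cyclotomic dual datum), unit content
of `fE` and `λ(fE) ≤ n₀` (`Iwasawa.le_lam_of_X_pow_dvd`). [cite: GreenbergLNM1716, §3 Lemma 3.1 and §1 p. 65]
[cite: Wuthrich2014, Thm. 16 (p. 397)] -/
theorem ClassX3M.mordellWeilRank_le_of_wuthrichHalf_of_firstUnitIndex
    (hW16 : Wuthrich2014.thm16_halfEigenCharIdeal_dvd_cyclotomicPrime)
    (hmodD : nonempty_modularParametrizationData)
    (hX : ClassX3M W p) (hp4 : p % 4 = 1) {n₀ : ℕ} (hrec : MultFirstUnitIndexAt W p n₀) :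
    W.mordellWeilRank ≤ n₀ := by
  obtain ⟨κ, hκ, γ, hγ, hγ'⟩ := exists_isCyclotomic_isTopGenerator_isCyclotomicVariable_holds p
  obtain ⟨D⟩ := W.nonempty_selmerDualData_holds κ γ hγ
  haveI : Module.Finite (IwasawaAlgebra p) D.X := D.module_finite_holds hγ
  obtain ⟨fE, hchar⟩ := (charIdeal_isPrincipal_holds p D.X).principal
  have hchar' : D.charIdeal = Ideal.span {fE} := hchar
  obtain ⟨hXt, hfE, -, hlam⟩ :=
    hX.mu_zero_and_lam_le_of_wuthrichHalf_of_firstUnitIndex hW16 hmodD hp4 hrec hκ hγ hγ' D hchar'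
  exact (le_lam_of_X_pow_dvd hfE (X_pow_mordellWeilRank_dvd_of_charIdeal_eq_span W p hγ D hXt hchar')).trans
    hlam

/-- **`rank E(ℚ) ≤ n₀` on X3♯(M), `p ≡ 3 (mod 4)` (`p = 3` included), given the record.**
[cite: GreenbergLNM1716, §3 Lemma 3.1 and §1 p. 65] [cite: Wuthrich2014, Thm. 16 (p. 397)] -/
theorem ClassX3M.mordellWeilRank_le_of_wuthrichHalf_of_firstUnitIndex_odd
    (hW16 : Wuthrich2014.thm16_halfEigenCharIdeal_dvd_cyclotomicPrime)
    (hmodD : nonempty_modularParametrizationData)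
    (hX : ClassX3M W p) (hp4 : p % 4 = 3) {n₀ : ℕ} (hrec : MultOddFirstUnitIndexAt W p n₀) :
    W.mordellWeilRank ≤ n₀ := by
  obtain ⟨κ, hκ, γ, hγ, hγ'⟩ := exists_isCyclotomic_isTopGenerator_isCyclotomicVariable_holds p
  obtain ⟨D⟩ := W.nonempty_selmerDualData_holds κ γ hγ
  haveI : Module.Finite (IwasawaAlgebra p) D.X := D.module_finite_holds hγ
  obtain ⟨fE, hchar⟩ := (charIdeal_isPrincipal_holds p D.X).principal
  have hchar' : D.charIdeal = Ideal.span {fE} := hchar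
  obtain ⟨hXt, hfE, -, hlam⟩ :=
    hX.mu_zero_and_lam_le_of_wuthrichHalf_of_firstUnitIndex_odd hW16 hmodD hp4 hrec hκ hγ hγ' D hchar'
  exact (le_lam_of_X_pow_dvd hfE (X_pow_mordellWeilRank_dvd_of_charIdeal_eq_span W p hγ D hXt hchar')).trans
    hlam

/-! ### §3 The main conjecture at the pair, class level, on X3♯(M) -/

/-- **X3♯(M), `p ≡ 1 (mod 4)`: record at index `b` + budget `BudgetLeLambdaAt p W b` ⟹ the MAIN
CONJECTURE at the pair** — for EVERY cyclotomic dual datum: `X(E/ℚ_∞)` torsion, `μ(X) = 0`, `λ(X) = b`,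
`char_Λ X(E/ℚ_∞) = (g)` with `g` of unit content (data-level form with the series explicit:
`charIdeal_eq_span_of_wuthrichHalf_of_norm_coeff_of_budget`). p10's `budgetSqueeze`.
[cite: Wuthrich2014, Thm. 16 (p. 397)] [cite: EmertonPollackWeston2006, Cor. 3.2.5 and Thm. 3.1.1 (typed input's source on IRREDUCIBLE rows only; X3: see header)]
[cite: Washington1997, §13.2] -/
theorem ClassX3M.mainConjecture_of_wuthrichHalf_of_firstUnitIndex_of_budget
    (hW16 : Wuthrich2014.thm16_halfEigenCharIdeal_dvd_cyclotomicPrime)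
    (hmodD : nonempty_modularParametrizationData)
    (hX : ClassX3M W p) (hp4 : p % 4 = 1) {b : ℕ}
    (hrec : MultFirstUnitIndexAt W p b) (hbud : BudgetLeLambdaAt p W b)
    {κ : ZpExtension ℚ p} {γ : Field.absoluteGaloisGroup ℚ}
    (hκ : κ.IsCyclotomic) (hγ : κ.IsTopGenerator γ) (hγ' : IsCyclotomicVariable p γ)
    (D : W.SelmerDualData κ γ) :
    D.IsTorsion ∧ D.mu = 0 ∧ lambdaInvariant p D.X = b ∧
      ∃ g : IwasawaAlgebra p, D.charIdeal = Ideal.span {g} ∧ HasUnitContent g := by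
  obtain ⟨hXt, g, hg, hunit, hlam⟩ :=
    hX.isTorsion_and_exists_unitContent_lam_le_of_wuthrichHalf_of_firstUnitIndex hW16 hmodD hp4 hrec hκ
      hγ hγ' D
  haveI : Module.Finite (IwasawaAlgebra p) D.X := D.module_finite_holds hγ
  obtain ⟨fE, hchar, -⟩ := exists_charIdeal_eq_span_singleton p D
  have hdvd : fE ∣ g := Ideal.mem_span_singleton.mp (hchar ▸ hg)
  obtain ⟨hspan, hmu, hlamD⟩ := budgetSqueeze p W hbud hκ hγ hγ' D hXt hchar hunit hdvd hlam
  exact ⟨hXt, hmu, hlamD, g, hchar.trans hspan.symm, hunit⟩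

/-- **X3♯(M), `p ≡ 3 (mod 4)` (`p = 3` included): record at index `b` + budget ⟹ the main conjecture at
the pair** (`μ(X) = 0`, `λ(X) = b`, `char = (g)` with `g` of unit content).
[cite: Wuthrich2014, Thm. 16 (p. 397)] [cite: EmertonPollackWeston2006, Cor. 3.2.5 and Thm. 3.1.1 (typed input's source on IRREDUCIBLE rows only; X3: see header)]
[cite: Washington1997, §13.2] -/
theorem ClassX3M.mainConjecture_of_wuthrichHalf_of_firstUnitIndex_of_budget_odd
    (hW16 : Wuthrich2014.thm16_halfEigenCharIdeal_dvd_cyclotomicPrime)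
    (hmodD : nonempty_modularParametrizationData)
    (hX : ClassX3M W p) (hp4 : p % 4 = 3) {b : ℕ}
    (hrec : MultOddFirstUnitIndexAt W p b) (hbud : BudgetLeLambdaAt p W b)
    {κ : ZpExtension ℚ p} {γ : Field.absoluteGaloisGroup ℚ}
    (hκ : κ.IsCyclotomic) (hγ : κ.IsTopGenerator γ) (hγ' : IsCyclotomicVariable p γ)
    (D : W.SelmerDualData κ γ) :
    D.IsTorsion ∧ D.mu = 0 ∧ lambdaInvariant p D.X = b ∧
      ∃ g : IwasawaAlgebra p, D.charIdeal = Ideal.span {g} ∧ HasUnitContent g := by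
  obtain ⟨hXt, g, hg, hunit, hlam⟩ :=
    hX.isTorsion_and_exists_unitContent_lam_le_of_wuthrichHalf_of_firstUnitIndex_odd hW16 hmodD hp4
      hrec hκ hγ hγ' D
  haveI : Module.Finite (IwasawaAlgebra p) D.X := D.module_finite_holds hγ
  obtain ⟨fE, hchar, -⟩ := exists_charIdeal_eq_span_singleton p D
  have hdvd : fE ∣ g := Ideal.mem_span_singleton.mp (hchar ▸ hg)
  obtain ⟨hspan, hmu, hlamD⟩ := budgetSqueeze p W hbud hκ hγ hγ' D hXt hchar hunit hdvd hlam
  exact ⟨hXt, hmu, hlamD, g, hchar.trans hspan.symm, hunit⟩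

/-- **MINIMAL X3♯(M) ROWS, `p ≡ 1 (mod 4)`: a record at index `rank E(ℚ)` gives the main conjecture
at the pair with NO lower input** — for EVERY cyclotomic dual datum and EVERY generator `fE` of
`char_Λ X(E/ℚ_∞)`: `X` torsion, `λ(fE) = rank E(ℚ)`, `μ(fE) = 0`, `ord_{T=0} fE = rank E(ℚ)` and
`[T^{rank}] fE ∈ ℤ_p^×` (iw-1's `Iwasawa.minimal_package`; T-O7KM-X3's certified rank-one rows are the
case `rank = 1`). [cite: GreenbergLNM1716, §3 Lemma 3.1 (T^{rank} ∣ char)]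
[cite: SteinWuthrich2013, §11 remark (p. 29)] [cite: Wuthrich2014, Thm. 16 (p. 397)] -/
theorem ClassX3M.minimalPackage_of_wuthrichHalf_of_firstUnitIndex_mordellWeilRank
    (hW16 : Wuthrich2014.thm16_halfEigenCharIdeal_dvd_cyclotomicPrime)
    (hmodD : nonempty_modularParametrizationData)
    (hX : ClassX3M W p) (hp4 : p % 4 = 1) (hrec : MultFirstUnitIndexAt W p W.mordellWeilRank)
    {κ : ZpExtension ℚ p} {γ : Field.absoluteGaloisGroup ℚ}
    (hκ : κ.IsCyclotomic) (hγ : κ.IsTopGenerator γ) (hγ' : IsCyclotomicVariable p γ)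
    (D : W.SelmerDualData κ γ) {fE : IwasawaAlgebra p} (hchar : D.charIdeal = Ideal.span {fE}) :
    D.IsTorsion ∧ lam fE = W.mordellWeilRank ∧ mu fE = 0 ∧ fE.order = W.mordellWeilRank ∧
      IsUnit (PowerSeries.coeff W.mordellWeilRank fE) := by
  obtain ⟨hXt, g, hg, hunit, hlam⟩ :=
    hX.isTorsion_and_exists_unitContent_lam_le_of_wuthrichHalf_of_firstUnitIndex hW16 hmodD hp4 hrec hκ
      hγ hγ' D
  haveI : Module.Finite (IwasawaAlgebra p) D.X := D.module_finite_holds hγ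
  have hdvd : fE ∣ g := Ideal.mem_span_singleton.mp (hchar ▸ hg)
  obtain ⟨-, hlamfE, -, hmufE, -, hord, hcoeff⟩ := minimal_package hunit hdvd
    (X_pow_mordellWeilRank_dvd_of_charIdeal_eq_span W p hγ D hXt hchar) hlam
  exact ⟨hXt, hlamfE, hmufE, hord, hcoeff⟩

/-- **MINIMAL X3♯(M) ROWS, `p ≡ 3 (mod 4)` (`p = 3` included): record at index `rank E(ℚ)` ⟹ for every
cyclotomic dual datum and generator `fE`: `λ(fE) = rank`, `μ(fE) = 0`, `ord_{T=0} fE = rank`,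
`[T^{rank}] fE ∈ ℤ_p^×`.** [cite: GreenbergLNM1716, §3 Lemma 3.1 (T^{rank} ∣ char)]
[cite: SteinWuthrich2013, §11 remark (p. 29)] [cite: Wuthrich2014, Thm. 16 (p. 397)] -/
theorem ClassX3M.minimalPackage_of_wuthrichHalf_of_firstUnitIndex_mordellWeilRank_odd
    (hW16 : Wuthrich2014.thm16_halfEigenCharIdeal_dvd_cyclotomicPrime)
    (hmodD : nonempty_modularParametrizationData)
    (hX : ClassX3M W p) (hp4 : p % 4 = 3) (hrec : MultOddFirstUnitIndexAt W p W.mordellWeilRank)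
    {κ : ZpExtension ℚ p} {γ : Field.absoluteGaloisGroup ℚ}
    (hκ : κ.IsCyclotomic) (hγ : κ.IsTopGenerator γ) (hγ' : IsCyclotomicVariable p γ)
    (D : W.SelmerDualData κ γ) {fE : IwasawaAlgebra p} (hchar : D.charIdeal = Ideal.span {fE}) :
    D.IsTorsion ∧ lam fE = W.mordellWeilRank ∧ mu fE = 0 ∧ fE.order = W.mordellWeilRank ∧
      IsUnit (PowerSeries.coeff W.mordellWeilRank fE) := by
  obtain ⟨hXt, g, hg, hunit, hlam⟩ :=
    hX.isTorsion_and_exists_unitContent_lam_le_of_wuthrichHalf_of_firstUnitIndex_odd hW16 hmodD hp4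
      hrec hκ hγ hγ' D
  haveI : Module.Finite (IwasawaAlgebra p) D.X := D.module_finite_holds hγ
  have hdvd : fE ∣ g := Ideal.mem_span_singleton.mp (hchar ▸ hg)
  obtain ⟨-, hlamfE, -, hmufE, -, hord, hcoeff⟩ := minimal_package hunit hdvd
    (X_pow_mordellWeilRank_dvd_of_charIdeal_eq_span W p hγ D hXt hchar) hlam
  exact ⟨hXt, hlamfE, hmufE, hord, hcoeff⟩

end Summit.BirchSwinnertonDyer.Rank1Residual.AdditivePotMult

end
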